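import Summits.CriticalPhenomena.PercolationContinuityZ3.Theorems.PercNearOneGluingNoHeavyLowerTailFourPointFaceDefs
import Mathlib.Data.Real.Basic
import Mathlib.Tactic.Ring
import Mathlib.Tactic.Linarith
import Mathlib.Tactic.Positivity
import HarnessLib

/-!
# `NoHeavyLowerTail` (stmt-CriticalPhenomena-4575) — (L2) from (L1): `polL₂ = polL₁ + hybE₃g + σ·β₃·(β₁+β₂)`

Support file (prover prim-l12-p6, line P6; `--supports stmt-CriticalPhenomena-4575`).  Pure algebra, no sorries, no definitions.
Since `m(D_bc) − m(G_bc) = β₁ + β₂` (`β₁ = «ab|cy»`, `β₂ = «ac|by»`, the two cells in which `b ≁ c` before and `b ~ c` after gluing `a = y`), the two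
polarised forms differ by the shape-(i) hybrid row plus a product of cells:  `polL₂ = polL₁ + hybE₃g + σ·«a|bcy»·(«ab|cy» + «ac|by»)` (`polL₂_eq_polL₁_add`).
Consequently (`polL₁_le_polL₂`) `polL₁ ≤ polL₂` whenever `hybE₃g ≥ 0` and the cells are nonnegative — and `hybE₃g = E₃({b≁c},{c≁a,c≁y},{b≁a,b≁y}) ≥ 0`
on every finite weighted graph is an instance (`c`; `P₁ = {b}`, `P₃ = P₃′ = {a,y}`) of prim-cert-2's theorem `HybridThreePointLB.sahiE3_hybrid_nonneg`.  So (L1) is the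
sharp one of the pair: every face / pencil / first-order statement of the P6 files for `polL₁` transfers to `polL₂` up to manifestly nonnegative terms.
[cite: GladkovZimin2024HK, §4 (the forms are this programme's)]
-/

namespace Summit.CriticalPhenomena.PercolationContinuityZ3.Theorems

namespace CubicFourPoint

variable {R : Type*} [CommRing R]

/-- `polL₂ = polL₁ + hybE₃g + σ·«a|bcy»·(«ab|cy» + «ac|by»)`. [this work] -/
theorem polL₂_eq_polL₁_add («a|b|c|y» «a|b|cy» «a|by|c» «a|bc|y» «ay|b|c» «ac|b|y» «ab|c|y» «a|bcy» «ay|bc» «ac|by» «acy|b» «ab|cy» «aby|c» «abc|y» «abcy» : R) :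
    polL₂ «a|b|c|y» «a|b|cy» «a|by|c» «a|bc|y» «ay|b|c» «ac|b|y» «ab|c|y» «a|bcy» «ay|bc» «ac|by» «acy|b» «ab|cy» «aby|c» «abc|y» «abcy» = polL₁ «a|b|c|y» «a|b|cy» «a|by|c» «a|bc|y» «ay|b|c» «ac|b|y» «ab|c|y» «a|bcy» «ay|bc» «ac|by» «acy|b» «ab|cy» «aby|c» «abc|y» «abcy» + hybE₃g «a|b|c|y» «a|b|cy» «a|by|c» «a|bc|y» «ay|b|c» «ac|b|y» «ab|c|y» «a|bcy» «ay|bc» «ac|by» «acy|b» «ab|cy» «aby|c» «abc|y» «abcy»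
      + («a|b|c|y» + «a|b|cy» + «a|by|c» + «a|bc|y» + «ay|b|c» + «ac|b|y» + «ab|c|y» + «a|bcy» + «ay|bc» + «ac|by» + «acy|b» + «ab|cy» + «aby|c» + «abc|y» + «abcy») * «a|bcy» * («ab|cy» + «ac|by») := by
  simp only [polL₂, polL₁]
  ring

/-- Hence `polL₁ ≤ polL₂` given the shape-(i) hybrid row `hybE₃g ≥ 0` and nonnegative cells. [this work] -/
theorem polL₁_le_polL₂ {«a|b|c|y» «a|b|cy» «a|by|c» «a|bc|y» «ay|b|c» «ac|b|y» «ab|c|y» «a|bcy» «ay|bc» «ac|by» «acy|b» «ab|cy» «aby|c» «abc|y» «abcy» : ℝ}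
    (h0 : 0 ≤ «a|b|c|y») (h1 : 0 ≤ «a|b|cy») (h2 : 0 ≤ «a|by|c») (h3 : 0 ≤ «a|bc|y») (h4 : 0 ≤ «ay|b|c») (h5 : 0 ≤ «ac|b|y») (h6 : 0 ≤ «ab|c|y») (h7 : 0 ≤ «a|bcy») (h8 : 0 ≤ «ay|bc») (h9 : 0 ≤ «ac|by») (h10 : 0 ≤ «acy|b») (h11 : 0 ≤ «ab|cy») (h12 : 0 ≤ «aby|c») (h13 : 0 ≤ «abc|y») (h14 : 0 ≤ «abcy»)
    (hE : 0 ≤ hybE₃g «a|b|c|y» «a|b|cy» «a|by|c» «a|bc|y» «ay|b|c» «ac|b|y» «ab|c|y» «a|bcy» «ay|bc» «ac|by» «acy|b» «ab|cy» «aby|c» «abc|y» «abcy») :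
    polL₁ «a|b|c|y» «a|b|cy» «a|by|c» «a|bc|y» «ay|b|c» «ac|b|y» «ab|c|y» «a|bcy» «ay|bc» «ac|by» «acy|b» «ab|cy» «aby|c» «abc|y» «abcy» ≤ polL₂ «a|b|c|y» «a|b|cy» «a|by|c» «a|bc|y» «ay|b|c» «ac|b|y» «ab|c|y» «a|bcy» «ay|bc» «ac|by» «acy|b» «ab|cy» «aby|c» «abc|y» «abcy» := by
  rw [polL₂_eq_polL₁_add]
  have hσ : 0 ≤ («a|b|c|y» + «a|b|cy» + «a|by|c» + «a|bc|y» + «ay|b|c» + «ac|b|y» + «ab|c|y» + «a|bcy» + «ay|bc» + «ac|by» + «acy|b» + «ab|cy» + «aby|c» + «abc|y» + «abcy») := by positivity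
  have hp : 0 ≤ («a|b|c|y» + «a|b|cy» + «a|by|c» + «a|bc|y» + «ay|b|c» + «ac|b|y» + «ab|c|y» + «a|bcy» + «ay|bc» + «ac|by» + «acy|b» + «ab|cy» + «aby|c» + «abc|y» + «abcy») * «a|bcy» * («ab|cy» + «ac|by») := by positivity
  linarith

end CubicFourPoint

end Summit.CriticalPhenomena.PercolationContinuityZ3.Theorems
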